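import Summits.NavierStokesRegularity.NavierStokesRegularity.Theorems.SqueezeCycleExtremalElementExistsRegularity
import Summits.NavierStokesRegularity.NavierStokesRegularity.Theorems.SqueezeCycleExtremalElementExistsRescale
import Summits.NavierStokesRegularity.NavierStokesRegularity.Theorems.RellichScarSymmetricScarExistsGaussianWindowLaw
import Literature.Analysis.FluidPDE.TypeIAncientMildClassical
import Literature.Analysis.FluidPDE.AncientSimilarityVariables
import Literature.Analysis.FluidPDE.CaloricRemainderCalculus
import HarnessLib

/-!
# Crux `NoTypeIBlowup` (stmt-NavierStokesRegularity-1217), line `head-flux-channel`: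
  STUB S2a, continuity of the Gaussian dissipation (`stub_gaussianDissipationContinuous`)

-- adapted from Cruxes/Target/S2aProof.lean (refuter-drefute), copied, not imported; the gradient
-- bound is re-derived from the KNSS window bound and the zoom directly (lighter import closure).

`stub_gaussianDissipationContinuous`: for a Type-I ancient mild field `u`
(`IsTypeIAncientMild C u`) and its Leray orbit `U = lerayOrbit u`
(`U(s, y) = e^{−s/2} u(−e^{−s}, e^{−s/2} y)`), the Gaussian dissipation
`D(s) = ∫ |∇U(s, y)|²_F e^{−‖y‖²/4} dy` is continuous in `s`.

Three accepted tree facts compose: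

* `exists_norm_iteratedFDeriv_le_of_typeI C 1` — the CLASS-UNIFORM bound `‖∇w(−1)(y)‖ ≤ K₀(C)`
  (KNSS 2009 Prop. 4.1 / (4.10), `k = 1`, window `[−2, −1/2)`) for every member `w` of the class,
  applied to the Navier–Stokes zoom `w = c • stPull (c²) c 0 0 u`, `c = e^{−s/2}`
  (`isTypeIAncientMild_zoom`), whose slice at `−1` IS the orbit slice `U(s)`
  (`HeadFluxChannelS2a.zoom_slice_neg_one_eq_lerayOrbit`); hence `‖∇U(s)(y)‖ ≤ K₀` GLOBALLY;
* `contDiff_uncurry_lerayOrbit` — the orbit is jointly smooth on `ℝ × ℝ³`;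
* `SymmetricScarExists.LogtimeBernoulli.continuous_integral_frobeniusNormSq_mul_gaussWeight`
  (sibling crux, accepted): continuity of `s ↦ ∫ |DU(s)|²_F g` for jointly smooth `U` with a
  global gradient bound (dominated convergence), `gaussWeight y = e^{−‖y‖²/4}` definitionally.

Lands `--supports stmt-NavierStokesRegularity-1217`.
-/

noncomputable section

namespace Summit.NavierStokesRegularity.NavierStokesRegularity.Theorems.HeadFluxChannelS2a

open MeasureTheory Set Filter Topology Function
open scoped RealInnerProductSpace
open Literature.Analysis.FluidPDE
open Literature.Analysis.FluidPDE.PineauVicol2026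
open Summit.NavierStokesRegularity.NavierStokesRegularity.Theorems
open Summit.NavierStokesRegularity.NavierStokesRegularity.Theorems.SymmetricScarExists.LogtimeBernoulli

/-- **The orbit slice is a zoom slice**: with `c = e^{−s/2}` (so `c² = e^{−s}`), the slice at
similarity time `s` of the Leray orbit is the slice at physical time `−1` of the Navier–Stokes
zoom `c • stPull (c²) c 0 0 u`, `(s', y) ↦ c u(c² s', c y)`. [folklore] -/
theorem zoom_slice_neg_one_eq_lerayOrbit
    (u : ℝ → EuclideanSpace ℝ (Fin 3) → EuclideanSpace ℝ (Fin 3)) (s : ℝ) :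
    (Real.exp (-s / 2) • stPull (Real.exp (-s / 2) ^ 2) (Real.exp (-s / 2)) 0 0 u) (-1) =
      lerayOrbit u s := by
  funext y
  rw [zoom_apply, lerayOrbit_apply, zero_add, sq, exp_neg_half_mul_self, mul_neg_one]

/-- **Global Leray-gauge gradient bound in similarity variables**: for every `C` there is
`K₀ = K₀(C)` with `‖∇U(s)(y)‖ ≤ K₀` for ALL `s, y` and every Type-I ancient mild field `u` with
constant `C`, `U = lerayOrbit u` (KNSS 2009 (4.10), `k = 1`, at time `−1` for the zoomed class
member whose `−1`-slice is `U(s)`). [cite: KochNadirashviliSereginSverak2009, Prop. 4.1 (4.6)/(4.10) with k = 1 and §1 (1.2) (arXiv:0709.3599v1 pp. 2, 8)] -/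
theorem exists_norm_fderiv_lerayOrbit_le (C : ℝ) :
    ∃ K₀ : ℝ, ∀ ⦃u : ℝ → EuclideanSpace ℝ (Fin 3) → EuclideanSpace ℝ (Fin 3)⦄,
      IsTypeIAncientMild C u → ∀ s y, ‖fderiv ℝ (lerayOrbit u s) y‖ ≤ K₀ := by
  obtain ⟨K₀, hK₀⟩ := exists_norm_iteratedFDeriv_le_of_typeI C 1 (a := -3) (b := -(1 / 2))
    (δ := 1) (by norm_num) (by norm_num) one_pos
  refine ⟨K₀, fun u hu s y => ?_⟩
  set c : ℝ := Real.exp (-s / 2) with hcdef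
  have hc : 0 < c := Real.exp_pos _
  -- the zoomed field is in the class
  have hw : IsTypeIAncientMild C (c • stPull (c ^ 2) c 0 0 u) := isTypeIAncientMild_zoom hu hc 0
  -- KNSS (4.10), `k = 1`, at `(-1, y)` for the zoomed field
  have h := hK₀ hw.continuousOn_uncurry (fun t ht => hw.isWeaklyDivFree ht)
    (fun t r htr hr x => hw.mild_eq_heatExtension htr hr x) hw.hasTypeITimeDecay (-1)
    ⟨by norm_num, by norm_num⟩ y
  rwa [norm_iteratedFDeriv_one, hcdef, zoom_slice_neg_one_eq_lerayOrbit] at h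

/-- **The orbit of a class member is jointly smooth on all of similarity space–time**
(`contDiff_uncurry_lerayOrbit` on the class smoothness clause). [folklore] -/
theorem isSmoothSpaceTimeOn_lerayOrbit {C : ℝ}
    {u : ℝ → EuclideanSpace ℝ (Fin 3) → EuclideanSpace ℝ (Fin 3)} (hu : IsTypeIAncientMild C u) :
    IsSmoothSpaceTimeOn univ (lerayOrbit u) :=
  IsSmoothSpaceTimeOn.of_contDiff_univ (contDiff_uncurry_lerayOrbit hu.contDiffOn)

end Summit.NavierStokesRegularity.NavierStokesRegularity.Theorems.HeadFluxChannelS2a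

/-! ## The stub -/

namespace Summit.NavierStokesRegularity.NavierStokesRegularity.Theorems

open MeasureTheory Set Filter Topology
open scoped RealInnerProductSpace
open Literature.Analysis.FluidPDE

/-- **stub_gaussianDissipationContinuous** (S2a, line `head-flux-channel` of crux `NoTypeIBlowup`)
— continuity of the Gaussian dissipation `s ↦ ∫ |∇U(s)|²_F e^{−‖y‖²/4}` along the Leray orbit
`U = lerayOrbit u` of a Type-I ancient mild field `u` (dominated convergence with the
class-uniform global gradient bound `‖∇U‖ ≤ K₀(C)` and joint smoothness of the orbit;
`PineauVicol2026.gaussWeight y = Real.exp (-‖y‖ ^ 2 / 4)` definitionally). [folklore] -/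
theorem stub_gaussianDissipationContinuous :
    ∀ (C : ℝ) (u : ℝ → EuclideanSpace ℝ (Fin 3) → EuclideanSpace ℝ (Fin 3)),
      IsTypeIAncientMild C u →
      Continuous (fun s : ℝ =>
          ∫ y, frobeniusNormSq (fderiv ℝ (lerayOrbit u s) y) * Real.exp (-‖y‖ ^ 2 / 4)) := by
  intro C u hu
  obtain ⟨K₀, hK₀⟩ := HeadFluxChannelS2a.exists_norm_fderiv_lerayOrbit_le C
  exact SymmetricScarExists.LogtimeBernoulli.continuous_integral_frobeniusNormSq_mul_gaussWeight
    (HeadFluxChannelS2a.isSmoothSpaceTimeOn_lerayOrbit hu) (hK₀ hu)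

end Summit.NavierStokesRegularity.NavierStokesRegularity.Theorems

end
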